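import Summits.CriticalPhenomena.PercolationContinuityZ3.Theorems.Transplant.FKDoubleFanOneSidedProducts
import HarnessLib

/-!
# Double fans, one-sided far pairs: the STRUCTURED NORMAL FORM of CORE (the fan-roof conjunct at the endpoint pair (roof, roof))

Helper file (`--supports stmt-CriticalPhenomena-4575`), FK sub-lane `prim-bschramm-fk-3` (gen 32); builds on p205010 (kernel theorem, internal audit
signed; external expert review pending).  Pure real algebra, no sorries; standard axioms.  Memo `bschramm/prim-bschramm-fk-3/FAR-CROSS-VII.md` §4, §6–§7.

The one inequality of LEMMA′ left open by `…OneSidedFinal` (`FanCore q`) is `roofF q t_f w_f (roofP q t_u w_u) (roofP q t_s w_s) ≥ 0`.  This file records its exact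
structure in the two tight probes `w_f, w_u` (**`roofF_roofP_roofP`**):
  `roofF = (1−q)(2−q)·coreStruct`,  `coreStruct = (2−q)²(1+q t_f)·P20·w_f² + (2−q)²(1+q t_u)·P02·w_u² + 2K·(2(1−q) + q(w_f+w_u))·w_f w_u + C22·w_f² w_u²`
with `P20 = q t_s t_u(1+t_s+t_u(1−w_s)²) + (1+t_s+t_u(1−w_s))² − w_s²(1+t_s) ≥ 0` (**`coreP20_nonneg`**), `P02 = q t_f t_s(t_f w_s²+t_s+1) + (t_f w_s+t_s)² + 2w_s(t_f+t_s) +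
t_s(1−w_s²) + w_s(2−w_s) ≥ 0` (**`coreP02_nonneg`**), the cross coefficient `K ≤ 0` (**`coreK_nonpos`**, 36 terms, bilinear in `t_f, t_u`; Bernstein certificate) and
`C22` (68 terms, sign-indefinite).  Consequences: the faces `w_u = 0`, `w_f = 0` are squares times non-negative factors (**`coreStruct_wu_zero`**, **`coreStruct_wf_zero`**);
the zero stratum `w_f = w_u = 1, w_s = 0, t_u = 0` (**`coreStruct_zero_stratum`**).  Positivity on the whole box is a corner square-completion problem
(`4·c20·c02 ≥ c11²` near `w_f = w_u = 0`, no termwise certificate exists) — see the memo for the `w_f`-free form `N ≤ (2−q)√(ab)`.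
[folklore]
-/

noncomputable section

namespace Summit.CriticalPhenomena.PercolationContinuityZ3.Theorems

namespace FK

namespace ThreeApex

/-- `P20(t_u,t_s,w_s)`: `CORE(w_u = 0) = (2−q)²(1+q t_f)·P20·w_f²`. [folklore] -/
def coreP20 (q tu ts ws : ℝ) : ℝ := q * ts * tu * (1 + ts + tu * (1 - ws) ^ 2) + (1 + ts + tu * (1 - ws)) ^ 2 - ws ^ 2 * (1 + ts)

/-- `P02(t_f,t_s,w_s)`: `CORE(w_f = 0) = (2−q)²(1+q t_u)·P02·w_u²`. [folklore] -/
def coreP02 (q tf ts ws : ℝ) : ℝ :=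
  q * tf * ts * (tf * ws ^ 2 + ts + 1) + (tf * ws + ts) ^ 2 + 2 * ws * (tf + ts) + ts * (1 - ws ^ 2) + ws * (2 - ws)

/-- The cross coefficient `K(t_f,t_u,t_s,w_s)` (`c11 = 4(1−q)K`, `c21 = c12 = 2qK`); `K ≤ 0`. [folklore] -/
def coreK (q tf tu ts ws : ℝ) : ℝ :=
    (1 : ℝ) * q ^ 3 * tf * ts ^ 2 * tu + (2 : ℝ) * q * tf * ts * tu * ws ^ 2 + ((-1) : ℝ) * q ^ 2 * tf * ts * ws ^ 2 + ((-2) : ℝ) * q ^ 2 * tf * ts ^ 2 * tu +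
    ((-1) : ℝ) * q ^ 2 * ts * tu * ws ^ 2 + ((-2) : ℝ) * q * tf * ts * tu * ws + (3 : ℝ) * q * tf * ts * ws ^ 2 + (3 : ℝ) * q * ts * tu * ws ^ 2 +
    (1 : ℝ) * q ^ 2 * tf * ts * tu + (1 : ℝ) * q ^ 2 * tf * ts ^ 2 + (2 : ℝ) * q ^ 2 * ts * tu * ws + (1 : ℝ) * q ^ 2 * ts ^ 2 * tu + ((-2) : ℝ) * q * tf * ts * tu +
    ((-2) : ℝ) * q * tf * ts ^ 2 + ((-6) : ℝ) * q * ts * tu * ws + ((-2) : ℝ) * q * ts ^ 2 * tu + (1 : ℝ) * q ^ 2 * tf * ts + (2 : ℝ) * tf * tu * ws ^ 2 +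
    ((-2) : ℝ) * q * tf * ts + (1 : ℝ) * q * ts * tu + (1 : ℝ) * q * ts ^ 2 + ((-2) : ℝ) * tf * ts * ws + ((-2) : ℝ) * tf * tu * ws + (2 : ℝ) * tf * ws ^ 2 +
    (2 : ℝ) * ts * tu * ws + (2 : ℝ) * ts * ws ^ 2 + (2 : ℝ) * tu * ws ^ 2 + (1 : ℝ) * q * ts + ((-2) : ℝ) * tf * ws + ((-2) : ℝ) * ts * tu + ((-2) : ℝ) * ts * ws +
    ((-2) : ℝ) * ts ^ 2 + ((-2) : ℝ) * tu * ws + (2 : ℝ) * ws ^ 2 + ((-2) : ℝ) * ts + ((-2) : ℝ) * ws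

/-- The coefficient `C22(t_f,t_u,t_s,w_s)` of `w_f² w_u²` (sign-indefinite). [folklore] -/
def coreC22 (q tf tu ts ws : ℝ) : ℝ :=
    (2 : ℝ) * q ^ 3 * tf * ts * tu * ws ^ 2 + ((-2) : ℝ) * q ^ 4 * tf * ts ^ 2 * tu + ((-8) : ℝ) * q ^ 2 * tf * ts * tu * ws ^ 2 + ((-2) : ℝ) * q ^ 3 * tf * ts * tu * ws +
    (2 : ℝ) * q ^ 3 * tf * ts * ws ^ 2 + (4 : ℝ) * q ^ 3 * tf * ts ^ 2 * tu + (2 : ℝ) * q ^ 3 * ts * tu * ws ^ 2 + ((-1) : ℝ) * q ^ 4 * tf * ts * tu +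
    (8 : ℝ) * q ^ 2 * tf * ts * tu * ws + ((-4) : ℝ) * q ^ 2 * tf * ts * ws ^ 2 + (2 : ℝ) * q ^ 2 * tf * tu * ws ^ 2 + ((-4) : ℝ) * q ^ 2 * ts * tu * ws ^ 2 +
    (2 : ℝ) * q ^ 3 * tf * ts * tu + ((-2) : ℝ) * q ^ 3 * tf * ts ^ 2 + (1 : ℝ) * q ^ 3 * tf * ws ^ 2 + ((-4) : ℝ) * q ^ 3 * ts * tu * ws +
    ((-2) : ℝ) * q ^ 3 * ts ^ 2 * tu + (1 : ℝ) * q ^ 3 * tu * ws ^ 2 + ((-4) : ℝ) * q * tf * ts * ws ^ 2 + ((-8) : ℝ) * q * tf * tu * ws ^ 2 +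
    ((-4) : ℝ) * q * ts * tu * ws ^ 2 + ((-2) : ℝ) * q ^ 2 * tf * ts * ws + (4 : ℝ) * q ^ 2 * tf * ts ^ 2 + ((-2) : ℝ) * q ^ 2 * tf * tu * ws +
    ((-3) : ℝ) * q ^ 2 * tf * ws ^ 2 + (10 : ℝ) * q ^ 2 * ts * tu * ws + (2 : ℝ) * q ^ 2 * ts * ws ^ 2 + (4 : ℝ) * q ^ 2 * ts ^ 2 * tu + ((-3) : ℝ) * q ^ 2 * tu * ws ^ 2 +
    ((-3) : ℝ) * q ^ 3 * tf * ts + ((-1) : ℝ) * q ^ 3 * tf * tu + ((-1) : ℝ) * q ^ 3 * ts * tu + ((-2) : ℝ) * q ^ 3 * tu * ws + (8 : ℝ) * q * tf * ts * ws +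
    (8 : ℝ) * q * tf * tu * ws + ((-8) : ℝ) * q * ts * ws ^ 2 + (8 : ℝ) * q ^ 2 * tf * ts + (4 : ℝ) * q ^ 2 * tf * tu + ((-2) : ℝ) * q ^ 2 * tf * ws +
    (2 : ℝ) * q ^ 2 * ts * tu + ((-2) : ℝ) * q ^ 2 * ts * ws + ((-2) : ℝ) * q ^ 2 * ts ^ 2 + (8 : ℝ) * q ^ 2 * tu * ws + (2 : ℝ) * q ^ 2 * ws ^ 2 +
    ((-1) : ℝ) * q ^ 3 * tf + ((-4) : ℝ) * q * tf * ts + ((-4) : ℝ) * q * tf * tu + (8 : ℝ) * q * tf * ws + (8 : ℝ) * q * ts * ws + (4 : ℝ) * q * ts ^ 2 +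
    ((-8) : ℝ) * q * tu * ws + ((-8) : ℝ) * q * ws ^ 2 + (4 : ℝ) * q ^ 2 * tf + ((-3) : ℝ) * q ^ 2 * ts + ((-1) : ℝ) * q ^ 2 * tu + ((-2) : ℝ) * q ^ 2 * ws +
    ((-4) : ℝ) * tf * ws ^ 2 + ((-4) : ℝ) * tu * ws ^ 2 + ((-4) : ℝ) * q * tf + (8 : ℝ) * q * ts + (4 : ℝ) * q * tu + (8 : ℝ) * q * ws + ((-1) : ℝ) * q ^ 2 +
    (8 : ℝ) * tu * ws + (4 : ℝ) * q + ((-4) : ℝ) * ts + ((-4) : ℝ) * tu + ((-4) : ℝ)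

/-- **The structured CORE**: `c20 w_f² + c02 w_u² + 2K(2(1−q)+q(w_f+w_u)) w_f w_u + C22 w_f² w_u²`. [folklore] -/
def coreStruct (q tf wf tu wu ts ws : ℝ) : ℝ :=
  (2 - q) ^ 2 * (1 + q * tf) * coreP20 q tu ts ws * wf ^ 2 + (2 - q) ^ 2 * (1 + q * tu) * coreP02 q tf ts ws * wu ^ 2 +
    2 * coreK q tf tu ts ws * (2 * (1 - q) + q * (wf + wu)) * (wf * wu) + coreC22 q tf tu ts ws * (wf ^ 2 * wu ^ 2)

set_option maxHeartbeats 8000000 in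
/-- **CORE identity**: at the endpoint pair (roof, roof) the fan-roof functional is `(1−q)(2−q)·coreStruct` (heartbeats raised for the identity). [folklore] -/
theorem roofF_roofP_roofP (q tf wf tu wu ts ws : ℝ) :
    roofF q tf wf (roofP q tu wu) (roofP q ts ws) = (1 - q) * (2 - q) * coreStruct q tf wf tu wu ts ws := by
  simp only [roofF, phiX, phiZ, phi0, condA, condN, condC1, condC2, condC10, nform, roofP, u0R, xwR, zwR, coreStruct, coreP20, coreP02,
    coreK, coreC22]
  ring

/-- `P20 ≥ 0` (`t_u, t_s ≥ 0`, `w_s ∈ [0,1]`, `q ≥ 0`): `(1+t_s+t_u(1−w_s))² ≥ (1+t_s)² ≥ w_s²(1+t_s)`. [folklore] -/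
theorem coreP20_nonneg {q tu ts ws : ℝ} (hq0 : 0 ≤ q) (htu : 0 ≤ tu) (hts : 0 ≤ ts) (hws0 : 0 ≤ ws) (hws1 : ws ≤ 1) : 0 ≤ coreP20 q tu ts ws := by
  have hw' : 0 ≤ 1 - ws := sub_nonneg.2 hws1
  have h1 : 0 ≤ q * ts * tu * (1 + ts + tu * (1 - ws) ^ 2) := by positivity
  have h2 : ws ^ 2 * (1 + ts) ≤ (1 + ts + tu * (1 - ws)) ^ 2 := by
    have hw2 : ws ^ 2 ≤ 1 := by nlinarith
    have h3 : (1 + ts) ≤ 1 + ts + tu * (1 - ws) := by nlinarith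
    have h4 : (1 + ts) * 1 ≤ (1 + ts + tu * (1 - ws)) ^ 2 := by nlinarith
    nlinarith
  simp only [coreP20]; linarith

/-- `P02 ≥ 0` (`t_f, t_s ≥ 0`, `w_s ∈ [0,1]`, `q ≥ 0`). [folklore] -/
theorem coreP02_nonneg {q tf ts ws : ℝ} (hq0 : 0 ≤ q) (htf : 0 ≤ tf) (hts : 0 ≤ ts) (hws0 : 0 ≤ ws) (hws1 : ws ≤ 1) : 0 ≤ coreP02 q tf ts ws := by
  have hw' : 0 ≤ 1 - ws := sub_nonneg.2 hws1
  have e : coreP02 q tf ts ws = q * tf * ts * (tf * ws ^ 2 + ts + 1) + (tf * ws + ts) ^ 2 + 2 * ws * (tf + ts) + ts * ((1 - ws) * (1 + ws)) +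
      ws * (1 + (1 - ws)) := by simp only [coreP02]; ring
  rw [e]; positivity

set_option maxHeartbeats 1000000 in
/-- `K ≤ 0` (`t ≥ 0`, `w_s ∈ [0,1]`, `q ∈ [0,1]`): `−K` has a Bernstein expansion with non-negative coefficients. [folklore] -/
theorem coreK_nonpos {q tf tu ts ws : ℝ} (hq0 : 0 ≤ q) (hq1 : q ≤ 1) (htf : 0 ≤ tf) (htu : 0 ≤ tu) (hts : 0 ≤ ts) (hws0 : 0 ≤ ws) (hws1 : ws ≤ 1) :
    coreK q tf tu ts ws ≤ 0 := by
  have hq' : 0 ≤ 1 - q := sub_nonneg.2 hq1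
  have hw' : 0 ≤ 1 - ws := sub_nonneg.2 hws1
  have e : -coreK q tf tu ts ws =
      (2 : ℝ) * (1 - q) ^ 3 * (1 - ws) ^ 2 * ts + (2 : ℝ) * (1 - q) ^ 3 * (1 - ws) ^ 2 * ts ^ 2 + (2 : ℝ) * (1 - q) ^ 3 * (1 - ws) ^ 2 * tu * ts +
      (2 : ℝ) * (1 - q) ^ 3 * ws * (1 - ws) + (6 : ℝ) * (1 - q) ^ 3 * ws * (1 - ws) * ts + (4 : ℝ) * (1 - q) ^ 3 * ws * (1 - ws) * ts ^ 2 +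
      (2 : ℝ) * (1 - q) ^ 3 * ws * (1 - ws) * tu + (2 : ℝ) * (1 - q) ^ 3 * ws * (1 - ws) * tu * ts + (2 : ℝ) * (1 - q) ^ 3 * ws * (1 - ws) * tf +
      (2 : ℝ) * (1 - q) ^ 3 * ws * (1 - ws) * tf * ts + (2 : ℝ) * (1 - q) ^ 3 * ws * (1 - ws) * tf * tu + (2 : ℝ) * (1 - q) ^ 3 * ws ^ 2 * ts +
      (2 : ℝ) * (1 - q) ^ 3 * ws ^ 2 * ts ^ 2 + (2 : ℝ) * (1 - q) ^ 3 * ws ^ 2 * tf * ts + (5 : ℝ) * q * (1 - q) ^ 2 * (1 - ws) ^ 2 * ts +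
      (5 : ℝ) * q * (1 - q) ^ 2 * (1 - ws) ^ 2 * ts ^ 2 + (5 : ℝ) * q * (1 - q) ^ 2 * (1 - ws) ^ 2 * tu * ts + (2 : ℝ) * q * (1 - q) ^ 2 * (1 - ws) ^ 2 * tu * ts ^ 2 +
      (2 : ℝ) * q * (1 - q) ^ 2 * (1 - ws) ^ 2 * tf * ts + (2 : ℝ) * q * (1 - q) ^ 2 * (1 - ws) ^ 2 * tf * ts ^ 2 +
      (2 : ℝ) * q * (1 - q) ^ 2 * (1 - ws) ^ 2 * tf * tu * ts + (6 : ℝ) * q * (1 - q) ^ 2 * ws * (1 - ws) + (16 : ℝ) * q * (1 - q) ^ 2 * ws * (1 - ws) * ts +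
      (10 : ℝ) * q * (1 - q) ^ 2 * ws * (1 - ws) * ts ^ 2 + (6 : ℝ) * q * (1 - q) ^ 2 * ws * (1 - ws) * tu + (10 : ℝ) * q * (1 - q) ^ 2 * ws * (1 - ws) * tu * ts +
      (4 : ℝ) * q * (1 - q) ^ 2 * ws * (1 - ws) * tu * ts ^ 2 + (6 : ℝ) * q * (1 - q) ^ 2 * ws * (1 - ws) * tf + (10 : ℝ) * q * (1 - q) ^ 2 * ws * (1 - ws) * tf * ts +
      (4 : ℝ) * q * (1 - q) ^ 2 * ws * (1 - ws) * tf * ts ^ 2 + (6 : ℝ) * q * (1 - q) ^ 2 * ws * (1 - ws) * tf * tu +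
      (6 : ℝ) * q * (1 - q) ^ 2 * ws * (1 - ws) * tf * tu * ts + (5 : ℝ) * q * (1 - q) ^ 2 * ws ^ 2 * ts + (5 : ℝ) * q * (1 - q) ^ 2 * ws ^ 2 * ts ^ 2 +
      (2 : ℝ) * q * (1 - q) ^ 2 * ws ^ 2 * tu * ts + (2 : ℝ) * q * (1 - q) ^ 2 * ws ^ 2 * tu * ts ^ 2 + (5 : ℝ) * q * (1 - q) ^ 2 * ws ^ 2 * tf * ts +
      (2 : ℝ) * q * (1 - q) ^ 2 * ws ^ 2 * tf * ts ^ 2 + (2 : ℝ) * q * (1 - q) ^ 2 * ws ^ 2 * tf * tu * ts + (4 : ℝ) * q ^ 2 * (1 - q) * (1 - ws) ^ 2 * ts +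
      (4 : ℝ) * q ^ 2 * (1 - q) * (1 - ws) ^ 2 * ts ^ 2 + (4 : ℝ) * q ^ 2 * (1 - q) * (1 - ws) ^ 2 * tu * ts + (3 : ℝ) * q ^ 2 * (1 - q) * (1 - ws) ^ 2 * tu * ts ^ 2 +
      (3 : ℝ) * q ^ 2 * (1 - q) * (1 - ws) ^ 2 * tf * ts + (3 : ℝ) * q ^ 2 * (1 - q) * (1 - ws) ^ 2 * tf * ts ^ 2 +
      (3 : ℝ) * q ^ 2 * (1 - q) * (1 - ws) ^ 2 * tf * tu * ts + (2 : ℝ) * q ^ 2 * (1 - q) * (1 - ws) ^ 2 * tf * tu * ts ^ 2 + (6 : ℝ) * q ^ 2 * (1 - q) * ws * (1 - ws) +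
      (14 : ℝ) * q ^ 2 * (1 - q) * ws * (1 - ws) * ts + (8 : ℝ) * q ^ 2 * (1 - q) * ws * (1 - ws) * ts ^ 2 + (6 : ℝ) * q ^ 2 * (1 - q) * ws * (1 - ws) * tu +
      (12 : ℝ) * q ^ 2 * (1 - q) * ws * (1 - ws) * tu * ts + (6 : ℝ) * q ^ 2 * (1 - q) * ws * (1 - ws) * tu * ts ^ 2 + (6 : ℝ) * q ^ 2 * (1 - q) * ws * (1 - ws) * tf +
      (12 : ℝ) * q ^ 2 * (1 - q) * ws * (1 - ws) * tf * ts + (6 : ℝ) * q ^ 2 * (1 - q) * ws * (1 - ws) * tf * ts ^ 2 + (6 : ℝ) * q ^ 2 * (1 - q) * ws * (1 - ws) * tf * tu +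
      (10 : ℝ) * q ^ 2 * (1 - q) * ws * (1 - ws) * tf * tu * ts + (4 : ℝ) * q ^ 2 * (1 - q) * ws * (1 - ws) * tf * tu * ts ^ 2 + (4 : ℝ) * q ^ 2 * (1 - q) * ws ^ 2 * ts +
      (4 : ℝ) * q ^ 2 * (1 - q) * ws ^ 2 * ts ^ 2 + (3 : ℝ) * q ^ 2 * (1 - q) * ws ^ 2 * tu * ts + (3 : ℝ) * q ^ 2 * (1 - q) * ws ^ 2 * tu * ts ^ 2 +
      (4 : ℝ) * q ^ 2 * (1 - q) * ws ^ 2 * tf * ts + (3 : ℝ) * q ^ 2 * (1 - q) * ws ^ 2 * tf * ts ^ 2 + (3 : ℝ) * q ^ 2 * (1 - q) * ws ^ 2 * tf * tu * ts +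
      (2 : ℝ) * q ^ 2 * (1 - q) * ws ^ 2 * tf * tu * ts ^ 2 + (1 : ℝ) * q ^ 3 * (1 - ws) ^ 2 * ts + (1 : ℝ) * q ^ 3 * (1 - ws) ^ 2 * ts ^ 2 +
      (1 : ℝ) * q ^ 3 * (1 - ws) ^ 2 * tu * ts + (1 : ℝ) * q ^ 3 * (1 - ws) ^ 2 * tu * ts ^ 2 + (1 : ℝ) * q ^ 3 * (1 - ws) ^ 2 * tf * ts +
      (1 : ℝ) * q ^ 3 * (1 - ws) ^ 2 * tf * ts ^ 2 + (1 : ℝ) * q ^ 3 * (1 - ws) ^ 2 * tf * tu * ts + (1 : ℝ) * q ^ 3 * (1 - ws) ^ 2 * tf * tu * ts ^ 2 +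
      (2 : ℝ) * q ^ 3 * ws * (1 - ws) + (4 : ℝ) * q ^ 3 * ws * (1 - ws) * ts + (2 : ℝ) * q ^ 3 * ws * (1 - ws) * ts ^ 2 + (2 : ℝ) * q ^ 3 * ws * (1 - ws) * tu +
      (4 : ℝ) * q ^ 3 * ws * (1 - ws) * tu * ts + (2 : ℝ) * q ^ 3 * ws * (1 - ws) * tu * ts ^ 2 + (2 : ℝ) * q ^ 3 * ws * (1 - ws) * tf +
      (4 : ℝ) * q ^ 3 * ws * (1 - ws) * tf * ts + (2 : ℝ) * q ^ 3 * ws * (1 - ws) * tf * ts ^ 2 + (2 : ℝ) * q ^ 3 * ws * (1 - ws) * tf * tu +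
      (4 : ℝ) * q ^ 3 * ws * (1 - ws) * tf * tu * ts + (2 : ℝ) * q ^ 3 * ws * (1 - ws) * tf * tu * ts ^ 2 + (1 : ℝ) * q ^ 3 * ws ^ 2 * ts +
      (1 : ℝ) * q ^ 3 * ws ^ 2 * ts ^ 2 + (1 : ℝ) * q ^ 3 * ws ^ 2 * tu * ts + (1 : ℝ) * q ^ 3 * ws ^ 2 * tu * ts ^ 2 + (1 : ℝ) * q ^ 3 * ws ^ 2 * tf * ts +
      (1 : ℝ) * q ^ 3 * ws ^ 2 * tf * ts ^ 2 + (1 : ℝ) * q ^ 3 * ws ^ 2 * tf * tu * ts + (1 : ℝ) * q ^ 3 * ws ^ 2 * tf * tu * ts ^ 2 := by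
    simp only [coreK]; ring
  have h : 0 ≤ -coreK q tf tu ts ws := by rw [e]; positivity
  linarith

/-- The face `w_u = 0`: `coreStruct = (2−q)²(1+q t_f)·P20·w_f²`. [folklore] -/
theorem coreStruct_wu_zero (q tf wf tu ts ws : ℝ) :
    coreStruct q tf wf tu 0 ts ws = (2 - q) ^ 2 * (1 + q * tf) * coreP20 q tu ts ws * wf ^ 2 := by
  simp only [coreStruct]; ring

/-- The face `w_f = 0`: `coreStruct = (2−q)²(1+q t_u)·P02·w_u²`. [folklore] -/
theorem coreStruct_wf_zero (q tf tu wu ts ws : ℝ) :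
    coreStruct q tf 0 tu wu ts ws = (2 - q) ^ 2 * (1 + q * tu) * coreP02 q tf ts ws * wu ^ 2 := by
  simp only [coreStruct]; ring

/-- The zero stratum `w_f = w_u = 1`, `w_s = 0`, `t_u = 0`: `coreStruct = 0` for all `q, t_f, t_s`. [folklore] -/
theorem coreStruct_zero_stratum (q tf ts : ℝ) : coreStruct q tf 1 0 1 ts 0 = 0 := by
  simp only [coreStruct, coreP20, coreP02, coreK, coreC22]; ring

/-- The edge `w_f = w_u = 1`, `w_s = 0`: `coreStruct = (2−q)² t_u(1+t_u)(1+q t_f)(1+q t_s)` (linear vanishing at `t_u = 0`). [folklore] -/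
theorem coreStruct_one_one_zero (q tf tu ts : ℝ) :
    coreStruct q tf 1 tu 1 ts 0 = (2 - q) ^ 2 * tu * (1 + tu) * (1 + q * tf) * (1 + q * ts) := by
  simp only [coreStruct, coreP20, coreP02, coreK, coreC22]; ring

/-- Faces are non-negative: `roofF ≥ 0` at (roof, roof) when `w_u = 0`. [folklore] -/
theorem roofF_roofP_roofP_nonneg_wu_zero {q tf wf tu ts ws : ℝ} (hq0 : 0 ≤ q) (hq1 : q ≤ 1) (htf : 0 ≤ tf) (htu : 0 ≤ tu) (hts : 0 ≤ ts)
    (hws0 : 0 ≤ ws) (hws1 : ws ≤ 1) : 0 ≤ roofF q tf wf (roofP q tu 0) (roofP q ts ws) := by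
  rw [roofF_roofP_roofP, coreStruct_wu_zero]
  have := sub_nonneg.2 hq1
  have : 0 ≤ 2 - q := by linarith
  have := coreP20_nonneg hq0 htu hts hws0 hws1
  positivity

/-- Faces are non-negative: `roofF ≥ 0` at (roof, roof) when `w_f = 0`. [folklore] -/
theorem roofF_roofP_roofP_nonneg_wf_zero {q tf tu wu ts ws : ℝ} (hq0 : 0 ≤ q) (hq1 : q ≤ 1) (htf : 0 ≤ tf) (htu : 0 ≤ tu) (hts : 0 ≤ ts)
    (hws0 : 0 ≤ ws) (hws1 : ws ≤ 1) : 0 ≤ roofF q tf 0 (roofP q tu wu) (roofP q ts ws) := by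
  rw [roofF_roofP_roofP, coreStruct_wf_zero]
  have := sub_nonneg.2 hq1
  have : 0 ≤ 2 - q := by linarith
  have := coreP02_nonneg hq0 htf hts hws0 hws1
  positivity

end ThreeApex

end FK

end Summit.CriticalPhenomena.PercolationContinuityZ3.Theorems
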